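import Literature.Computability.AlgebraicComplexity.KempfTorusWeights
import HarnessLib

/-!
# Kempf's optimal one-parameter subgroups for `SL_σ`, II: the numerical function of a closed orbit,
# its `P_a`-invariance and Weyl covariance, and positivity at a limit (Kempf 1978, Lemma 3.2 and
# Thm. 1.4, for `G = SL_σ`, `X = Sym^D (K^σ)`)

Second of three files formalising Kempf's optimal-parabolic theorem for `SL_σ(K)` acting on forms
(`K` algebraically closed of any characteristic; see `KempfTorusWeights.lean` for the plan). For a
form `Q` of degree `D` with CLOSED `SL`-orbit (the `S` of Kempf's §3) this file sets up:

* `TestSystem D Q` (§1): finitely many `twt`-isobaric generators `f_j` (classes `m_j`) of the ideal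
  of `formCoeff D '' SL·Q` (they exist over an infinite field: `nonempty_testSystem`); the STATE
  `J(u) = {j : f_j(u) ≠ 0}` of a polynomial `u`; ADMISSIBILITY `IsAdm u a` of a real weight vector
  `a ∈ ℝ^σ` ("`lim_{t→0} diag(t^a)·u` exists": all monomials of `u` have `⟨a,d⟩ ≥ 0`); and
  **Kempf's numerical function** `M(u, a) = min_{j ∈ J(u)} ⟨a, m_j⟩` — for the pair
  (`h ∈ SL`, `a`) standing for the virtual one-parameter subgroup `h⁻¹ diag(t^a) h` at `v`, one
  takes `u = h·v`. Off `S` the state is non-empty (`coeffVec_mem_zariskiClosure_of_J_eq_empty`).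
* §2 **Generator domination** (`M_le_rpair_of_aeval_ne_zero`): for admissible `(u,a)`, `M(u,a)` is
  also the minimum of `⟨a, m⟩` over ALL isobaric `f` in the ideal with `f(u) ≠ 0` — so `M` is
  intrinsic; and the core lemma `M_le_M_linSubst`: a `g ∈ SL` whose pullback lowers `a`-weights to
  `a'`-weights satisfies `M(u, a') ≤ M(g·u, a)`.
* §3 **Kempf's Lemma 3.2 (c)** `M_linSubst_eq_of_parabolic`: `M(q·u, a) = M(u, a)` and admissibility
  is preserved for `q ∈ SL ∩ P_a`, `P_a = {q : a_i < a_j ⇒ q_{ij} = 0}`; and the **Weyl covariance**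
  `M_linSubst_eq_of_perm`: `M(q·u, a) = M(u, a ∘ π)` for a monomial matrix `q` over `π`. Both for
  REAL weight vectors directly (one monomial computation, `KempfTorusWeights` §6), which is what lets
  part III optimise over `X_*(T) ⊗ ℝ` without a rational-approximation step.
* §4 **Positivity at a limit** (`M_pos_of_diagLimit_mem`, Kempf Lemma 3.2 (b) with Thm. 1.4): if
  `(u, a)` is admissible for an integral `a` and `lim_{t→0} diag(t^a)·u ∈ SL·Q`, then `M(u,a) > 0`.
  With `HilbertMumfordSLForms.exists_sl_diagLimit_mem_of_mem_zariskiClosure_slOrbit` this produces,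
  for a non-polystable form `v`, a pair with `M > 0` — the starting point of the optimisation.

DEFINITIONS (with bodies; no named facts): `TestSystem` (structure), `TestSystem.J`, `IsAdm`,
`TestSystem.M`. Honest framing: classical invariant theory (1978) in the tree's currency, towards
`MS2001_thm_4_6`/`MS2001_thm_4_7` over arbitrary algebraically closed fields; nothing here bears on
`VP` versus `VNP`. Cell `val-lit`, seat t14 g7.

## References

* [Kempf1978] G. R. Kempf, *Instability in invariant theory*, Ann. of Math. (2) 108 (1978)
  299–316: §2 (`P(λ)`, the Weyl group on `X_*(T)`), Lemma 3.2, Thm. 3.4, Cor. 3.5, Thm. 1.4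
  (cite-only; the specialisation to `SL_σ` on `Sym^D` and the generator form of `m(x,λ)` are ours).
* [MumfordFogartyKirwan1994] D. Mumford, J. Fogarty, F. Kirwan, *Geometric Invariant Theory*,
  3rd ed., Ch. 2 §1–§2 (held: `book:mumford1994-geometric-invariant-theory`).
* [MulmuleySohoniSIAM2001] K. Mulmuley, M. Sohoni, *GCT I*, SIAM J. Comput. 31 (2001), §3 and
  the proofs of Thms. 4.6/4.7 ("Kempf's criterion").
-/

noncomputable section

open scoped BigOperators Polynomial
open MvPolynomial

namespace Literature.Computability.AlgebraicComplexity

/-! ## Kempf's numerical function for `SL_σ` on `Sym^D` -/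

section NumericalFunction

variable {K : Type} [Field K] {σ : Type} [Fintype σ] [DecidableEq σ] {D : ℕ}

/-- For `∑ a = 0`: `⟨a, twt d⟩ = N · ∑_i a_i d_i` — the traceless weight pairs with traceless
cocharacters like `N` times the naive weight. [cite: Kempf1978, §2 (weights of `T` on `X`)] -/
theorem rpair_twt (a : σ → ℝ) (ha : ∑ i, a i = 0) (d : DegIdx σ D) :
    rpair a (twt D d) = (Fintype.card σ : ℝ) * ∑ i, a i * (d.1 i : ℝ) := by
  simp only [rpair_apply, twt_apply, Int.cast_sub, Int.cast_mul, Int.cast_natCast, mul_sub,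
    Finset.sum_sub_distrib, ← Finset.sum_mul, ha, zero_mul, sub_zero, Finset.mul_sum]
  exact Finset.sum_congr rfl fun i _ => by ring

/-- **A system of isobaric test polynomials for the closed orbit `SL·Q`** (Kempf §3: the finitely
many `T`-weight data through which the numerical function `m(x, λ)` of a closed `G`-stable `S` is
computed; here `S = SL·Q ⊆ Sym^D` and the data are finitely many `twt`-isobaric generators
`f_1, …, f_r`, of classes `m_1, …, m_r`, of the vanishing ideal of `formCoeff D '' SL·Q`).
[cite: Kempf1978, Lemma 3.2 (the function `m(x, λ)` of a closed invariant `S`)] -/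
structure TestSystem (D : ℕ) (Q : MvPolynomial σ K) where
  /-- number of test polynomials -/
  r : ℕ
  /-- the test polynomials on `Sym^D` -/
  f : Fin r → MvPolynomial (DegIdx σ D) K
  /-- their `twt`-classes -/
  m : Fin r → σ → ℤ
  /-- each vanishes on `SL·Q` -/
  mem : ∀ j, f j ∈ MvPolynomial.vanishingIdeal K (formCoeff D '' slOrbit σ K Q)
  /-- each is isobaric -/
  iso : ∀ j, IsWeightedHomogeneous (twt D) (f j) (m j)
  /-- together they generate the ideal of `SL·Q` in `Sym^D` -/
  span : Ideal.span (Set.range f) = MvPolynomial.vanishingIdeal K (formCoeff D '' slOrbit σ K Q)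

/-- Test systems exist (`K` infinite): `exists_isobaric_span_vanishingIdeal_slOrbit`.
[cite: Kempf1978, Lemma 3.2] -/
theorem nonempty_testSystem [Infinite K] (Q : MvPolynomial σ K) : Nonempty (TestSystem D Q) := by
  obtain ⟨r, f, m, hmem, hiso, hspan⟩ := exists_isobaric_span_vanishingIdeal_slOrbit (D := D) Q
  exact ⟨⟨r, f, m, hmem, hiso, hspan⟩⟩

variable {Q : MvPolynomial σ K} (T : TestSystem D Q)

/-- **The state of `u`**: the set `J(u)` of test polynomials not vanishing at the degree-`D`
coefficient vector of `u` (Kempf §3: the `T`-state of the point `x` relative to `S`).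
[cite: Kempf1978, Lemma 3.2] -/
def TestSystem.J (u : MvPolynomial σ K) : Finset (Fin T.r) := by
  classical exact Finset.univ.filter fun j => aeval (formCoeff D u) (T.f j) ≠ 0

/-- Membership in the state. [cite: Kempf1978, Lemma 3.2] -/
theorem TestSystem.mem_J {u : MvPolynomial σ K} {j : Fin T.r} :
    j ∈ T.J u ↔ aeval (formCoeff D u) (T.f j) ≠ 0 := by
  unfold TestSystem.J
  simp only [Finset.mem_filter, Finset.mem_univ, true_and]

/-- **Admissibility** of the real weight vector `a` at `u` (Kempf: "`lim_{t→0} λ(t)·x` exists",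
§1, for the virtual one-parameter subgroup `diag(t^a)`): every monomial of `u` has weight
`⟨a, d⟩ ≥ 0`. [cite: Kempf1978, §1–§2 (the set `|X, x|` of `λ` with a limit)] -/
def IsAdm (u : MvPolynomial σ K) (a : σ → ℝ) : Prop :=
  ∀ d ∈ u.support, 0 ≤ ∑ i, a i * (d i : ℝ)

/-- **Kempf's numerical function** `M(u, a) = min { ⟨a, m_j⟩ : f_j(u) ≠ 0 }` (Kempf §3, the
function `m(x, λ)` measuring the order to which `λ` drives `x` into `S`, written through the finitely
many weights of the state; `0` by convention on the empty state, which does not occur off `S`).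
[cite: Kempf1978, Lemma 3.2 (the function `m(x, λ)`)] -/
def TestSystem.M (u : MvPolynomial σ K) (a : σ → ℝ) : ℝ :=
  if h : (T.J u).Nonempty then (T.J u).inf' h (fun j => rpair a (T.m j)) else 0

/-- `M(u,a)` on a non-empty state is the `inf'`. [cite: Kempf1978, Lemma 3.2] -/
theorem TestSystem.M_eq_inf' {u : MvPolynomial σ K} (h : (T.J u).Nonempty) (a : σ → ℝ) :
    T.M u a = (T.J u).inf' h (fun j => rpair a (T.m j)) := by
  rw [TestSystem.M, dif_pos h]

/-- `M(u,a) ≤ ⟨a, m_j⟩` for every `j` in the state. [cite: Kempf1978, Lemma 3.2] -/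
theorem TestSystem.M_le_rpair_of_mem_J {u : MvPolynomial σ K} {j : Fin T.r} (hj : j ∈ T.J u)
    (a : σ → ℝ) : T.M u a ≤ rpair a (T.m j) := by
  rw [T.M_eq_inf' ⟨j, hj⟩]
  exact Finset.inf'_le _ hj

/-- `M(u,a)` is attained on a non-empty state. [cite: Kempf1978, Lemma 3.2] -/
theorem TestSystem.exists_mem_J_M_eq {u : MvPolynomial σ K} (h : (T.J u).Nonempty) (a : σ → ℝ) :
    ∃ j ∈ T.J u, T.M u a = rpair a (T.m j) := by
  rw [T.M_eq_inf' h]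
  exact Finset.exists_mem_eq_inf' h _

/-- A lower bound for `M(u,a)`: `r ≤ M(u,a)` iff `r ≤ ⟨a, m_j⟩` for all `j` in the (non-empty) state.
[cite: Kempf1978, Lemma 3.2] -/
theorem TestSystem.le_M_iff {u : MvPolynomial σ K} (h : (T.J u).Nonempty) {a : σ → ℝ} {r : ℝ} :
    r ≤ T.M u a ↔ ∀ j ∈ T.J u, r ≤ rpair a (T.m j) := by
  rw [T.M_eq_inf' h, Finset.le_inf'_iff]

/-- **The state is non-empty off `S`**: if all test polynomials vanish at `u` (a form of degree `D`,
`Q` a form of degree `D`), then `coeffVec u` lies in the Zariski closure of `coeffVec '' SL·Q`.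
[cite: Kempf1978, Lemma 3.2] -/
theorem TestSystem.coeffVec_mem_zariskiClosure_of_J_eq_empty (hQ : Q.IsHomogeneous D)
    {u : MvPolynomial σ K} (hu : u.IsHomogeneous D) (hJ : ¬ (T.J u).Nonempty) :
    coeffVec u ∈ zariskiClosure (coeffVec '' slOrbit σ K Q) := by
  apply coeffVec_mem_zariskiClosure_of_formCoeff_mem_zeroLocus (isHomogeneous_of_mem_slOrbit hQ) hu
  rw [MvPolynomial.mem_zeroLocus_iff]
  intro p hp
  rw [← T.span] at hp
  -- every generator vanishes at `formCoeff D u`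
  have hgen : ∀ j, aeval (formCoeff D u) (T.f j) = 0 := by
    intro j
    by_contra h
    exact hJ ⟨j, T.mem_J.mpr h⟩
  have hker : Ideal.span (Set.range T.f) ≤ RingHom.ker (aeval (formCoeff D u)).toRingHom := by
    rw [Ideal.span_le]
    rintro _ ⟨j, rfl⟩
    exact hgen j
  exact hker hp

/-- **Admissible weights pair non-negatively with the classes seen at `u`**: if `φ` is isobaric of
class `n`, `φ(u) ≠ 0`, `∑ a = 0` and every monomial of `u` has `a`-weight `≥ 0`, then `⟨a, n⟩ ≥ 0`
(a monomial of `φ` non-zero at `u` only involves coordinates `y_d` with `d ∈ supp u`).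
[cite: Kempf1978, Lemma 3.2 (b)] -/
theorem rpair_nonneg_of_aeval_formCoeff_ne_zero {u : MvPolynomial σ K} {a : σ → ℝ} (hadm : IsAdm u a)
    (ha : ∑ i, a i = 0) {φ : MvPolynomial (DegIdx σ D) K} {n : σ → ℤ}
    (hφ : IsWeightedHomogeneous (twt D) φ n) (hne : aeval (formCoeff D u) φ ≠ 0) : 0 ≤ rpair a n := by
  classical
  rw [φ.as_sum, map_sum] at hne
  obtain ⟨e, he, hne'⟩ := Finset.exists_ne_zero_of_sum_ne_zero hne
  rw [aeval_monomial, Finsupp.prod] at hne'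
  have hprod : ∀ d ∈ e.support, formCoeff D u d ≠ 0 := fun d hd h0 =>
    (right_ne_zero_of_mul hne') (Finset.prod_eq_zero hd (by
      rw [h0, zero_pow (Finsupp.mem_support_iff.mp hd)]))
  rw [← hφ (mem_support_iff.mp he), rpair_weight]
  refine Finset.sum_nonneg fun d hd => mul_nonneg (Nat.cast_nonneg _) ?_
  rw [rpair_twt a ha]
  refine mul_nonneg (Nat.cast_nonneg _) (hadm d.1 ?_)
  exact mem_support_iff.mpr (hprod d hd)

end NumericalFunction

section Domination

variable {K : Type} [Field K] {σ : Type} [Fintype σ] [DecidableEq σ] {D : ℕ}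

/-- The class-`m` component of `φ · ψ` for `ψ` isobaric of class `n` is `φ_{m−n} · ψ`.
[cite: Kempf1978, §2 (weights of `T` on `X`)] -/
theorem weightedHomogeneousComponent_mul_of_isWeightedHomogeneous {τ M : Type*} [AddCommGroup M]
    [DecidableEq M] {w : τ → M} (φ : MvPolynomial τ K) {ψ : MvPolynomial τ K} {n : M}
    (hψ : IsWeightedHomogeneous w ψ n) (m : M) :
    weightedHomogeneousComponent w m (φ * ψ) = weightedHomogeneousComponent w (m - n) φ * ψ := by
  classical
  ext d
  rw [coeff_weightedHomogeneousComponent, coeff_mul, coeff_mul]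
  split_ifs with hd
  · refine Finset.sum_congr rfl fun p hp => ?_
    rw [coeff_weightedHomogeneousComponent]
    by_cases hψ0 : coeff p.2 ψ = 0
    · rw [hψ0, mul_zero, mul_zero]
    · have hp2 : Finsupp.weight w p.2 = n := hψ hψ0
      have hp1 : Finsupp.weight w p.1 = m - n := by
        rw [Finset.HasAntidiagonal.mem_antidiagonal] at hp
        rw [← hd, ← hp, map_add, hp2, add_sub_cancel_right]
      rw [if_pos hp1]
  · symm
    refine Finset.sum_eq_zero fun p hp => ?_
    rw [coeff_weightedHomogeneousComponent]
    by_cases hψ0 : coeff p.2 ψ = 0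
    · rw [hψ0, mul_zero]
    · rw [if_neg, zero_mul]
      intro hp1
      apply hd
      rw [Finset.HasAntidiagonal.mem_antidiagonal] at hp
      rw [← hp, map_add, hp1, hψ hψ0, sub_add_cancel]

variable {Q : MvPolynomial σ K} (T : TestSystem D Q)

/-- **The generators control every isobaric element of the ideal** (Kempf's Lemma 3.2 reduced to
finitely many states): if `(u, a)` is admissible, `∑ a = 0`, and `f` is ANY isobaric element of the
ideal of `SL·Q`, of class `m`, with `f(u) ≠ 0`, then the state of `u` is non-empty and
`M(u,a) ≤ ⟨a, m⟩`. (Write `f = ∑ g_j f_j`, take class-`m` components: `f = ∑ (g_j)_{m−m_j} f_j`; some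
`(g_j)_{m−m_j}(u) f_j(u) ≠ 0`, and `⟨a, m − m_j⟩ ≥ 0` by admissibility.) [cite: Kempf1978, Lemma 3.2] -/
theorem TestSystem.M_le_rpair_of_aeval_ne_zero {u : MvPolynomial σ K} {a : σ → ℝ} (hadm : IsAdm u a)
    (ha : ∑ i, a i = 0) {f : MvPolynomial (DegIdx σ D) K} {m : σ → ℤ}
    (hfI : f ∈ MvPolynomial.vanishingIdeal K (formCoeff D '' slOrbit σ K Q))
    (hf : IsWeightedHomogeneous (twt D) f m) (hne : aeval (formCoeff D u) f ≠ 0) :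
    (T.J u).Nonempty ∧ T.M u a ≤ rpair a m := by
  classical
  rw [← T.span, Ideal.mem_span_range_iff_exists_fun] at hfI
  obtain ⟨g, hg⟩ := hfI
  -- class-`m` components: `f = ∑_j (g_j)_{m − m_j} f_j`
  have hdec : ∑ j, weightedHomogeneousComponent (twt D) (m - T.m j) (g j) * T.f j = f := by
    conv_rhs => rw [← hf.weightedHomogeneousComponent_same, ← hg]
    rw [map_sum]
    exact Finset.sum_congr rfl fun j _ =>
      (weightedHomogeneousComponent_mul_of_isWeightedHomogeneous (g j) (T.iso j) m).symm
  rw [← hdec, map_sum] at hne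
  obtain ⟨j, -, hj⟩ := Finset.exists_ne_zero_of_sum_ne_zero hne
  rw [map_mul] at hj
  have hj1 : aeval (formCoeff D u) (weightedHomogeneousComponent (twt D) (m - T.m j) (g j)) ≠ 0 :=
    left_ne_zero_of_mul hj
  have hj2 : aeval (formCoeff D u) (T.f j) ≠ 0 := right_ne_zero_of_mul hj
  have hjJ : j ∈ T.J u := T.mem_J.mpr hj2
  refine ⟨⟨j, hjJ⟩, (T.M_le_rpair_of_mem_J hjJ a).trans ?_⟩
  have h0 := rpair_nonneg_of_aeval_formCoeff_ne_zero hadm ha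
    (weightedHomogeneousComponent_isWeightedHomogeneous (m - T.m j) (g j)) hj1
  rw [rpair_sub] at h0
  linarith

/-- **Weight-lowering substitutions do not increase the numerical function** (the common core of
Kempf's Lemma 3.2 (c) — `m(x, pλp⁻¹) = m(x, λ)` for `p ∈ P(λ)` — and of the Weyl-group covariance):
if `g ∈ SL` satisfies `coeff_d(g·x^e) ≠ 0 ⇒ ⟨a', twt e⟩ ≤ ⟨a, twt d⟩`, `(u, a')` is admissible and the
state of `g·u` is non-empty, then the state of `u` is non-empty and `M(u, a') ≤ M(g·u, a)`.
[cite: Kempf1978, Lemma 3.2 (c)] -/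
theorem TestSystem.M_le_M_linSubst [Infinite K] (g : Matrix.SpecialLinearGroup σ K) {u : MvPolynomial σ K}
    {a a' : σ → ℝ} (ha' : ∑ i, a' i = 0)
    (hlow : ∀ d e : DegIdx σ D, coeff d.1 (linSubst σ K (g : Matrix σ σ K) (monomial e.1 1)) ≠ 0 →
      rpair a' (twt D e) ≤ rpair a (twt D d))
    (hadm : IsAdm u a') (hJ : (T.J (linSubst σ K (g : Matrix σ σ K) u)).Nonempty) :
    (T.J u).Nonempty ∧ T.M u a' ≤ T.M (linSubst σ K (g : Matrix σ σ K) u) a := by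
  classical
  obtain ⟨j₀, hj₀, hM⟩ := T.exists_mem_J_M_eq hJ a
  rw [hM]
  -- the pulled-back test polynomial and its components
  set F := symPullback D (g : Matrix σ σ K) (T.f j₀) with hF
  have hFI : F ∈ MvPolynomial.vanishingIdeal K (formCoeff D '' slOrbit σ K Q) :=
    symPullback_mem_vanishingIdeal_slOrbit Q g (T.mem j₀)
  have hFne : aeval (formCoeff D u) F ≠ 0 := by
    rw [hF, aeval_formCoeff_symPullback]
    exact T.mem_J.mp hj₀
  -- some isobaric component of `F` does not vanish at `u`
  have hdec : ∑ n ∈ F.support.image (Finsupp.weight (twt D)),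
      weightedHomogeneousComponent (twt D) n F = F := by
    conv_rhs => rw [← sum_weightedHomogeneousComponent (twt D) F]
    rw [finsum_eq_sum_of_support_subset]
    intro n hn
    rw [Function.mem_support] at hn
    rw [Finset.mem_coe]
    by_contra hnot
    exact hn (weightedHomogeneousComponent_eq_zero' n F fun d hd h =>
      hnot (h ▸ Finset.mem_image_of_mem _ hd))
  rw [← hdec, map_sum] at hFne
  obtain ⟨n, hn, hne⟩ := Finset.exists_ne_zero_of_sum_ne_zero hFne
  have hcompI := weightedHomogeneousComponent_mem_vanishingIdeal
    (formCoeff_image_slOrbit_torusStable Q) hFI n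
  obtain ⟨hJu, hle⟩ := T.M_le_rpair_of_aeval_ne_zero hadm ha' hcompI
    (weightedHomogeneousComponent_isWeightedHomogeneous n F) hne
  refine ⟨hJu, hle.trans ?_⟩
  -- `n` is the weight of a monomial of `F`, whose `a'`-weights are `≤ ⟨a, m_{j₀}⟩`
  obtain ⟨e, he, rfl⟩ := Finset.mem_image.mp hn
  exact rpair_weight_le_of_mem_support_symPullback hlow
    (fun e' he' => by rw [(T.iso j₀) (mem_support_iff.mp he')]) e he

end Domination

section Invariance

variable {K : Type} [Field K] {σ : Type} [Fintype σ] [DecidableEq σ] {D : ℕ}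

/-- **`P_a` preserves admissibility**: if `a_i < a_j ⇒ q_{ij} = 0` and every monomial of `u` has
`a`-weight `≥ 0`, so does every monomial of `q·u`. [cite: Kempf1978, §2 (`P(λ)`)] -/
theorem IsAdm.linSubst_of_parabolic {q : Matrix σ σ K} {a : σ → ℝ}
    (hq : ∀ i j, q i j ≠ 0 → a j ≤ a i) {u : MvPolynomial σ K} (hadm : IsAdm u a) :
    IsAdm (linSubst σ K q u) a := by
  intro d hd
  have h := le_weight_of_mem_support_linSubst (ω := a) (ω' := a) hq (f := u) (r := 0)
    (fun e he => by rw [weight_eq_sum]; exact hadm e he) d hd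
  rwa [weight_eq_sum] at h

/-- **`P_a` lowers the weights of test monomials** (the hypothesis of `M_le_M_linSubst` for
`a' = a`). [cite: Kempf1978, Lemma 3.2 (c)] -/
theorem rpair_twt_le_of_parabolic {q : Matrix σ σ K} {a : σ → ℝ}
    (hq : ∀ i j, q i j ≠ 0 → a j ≤ a i) (ha : ∑ i, a i = 0) :
    ∀ d e : DegIdx σ D, coeff d.1 (linSubst σ K q (monomial e.1 1)) ≠ 0 →
      rpair a (twt D e) ≤ rpair a (twt D d) := by
  intro d e h
  rw [rpair_twt a ha, rpair_twt a ha]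
  exact mul_le_mul_of_nonneg_left (le_weight_of_coeff_linSubst_monomial_ne_zero hq h)
    (Nat.cast_nonneg _)

/-- A monomial matrix for `π` transports admissibility from `a ∘ π` to `a`.
[cite: Kempf1978, §2 (the Weyl group acting on `X_*(T)`)] -/
theorem IsAdm.linSubst_of_perm {q : Matrix σ σ K} {π : Equiv.Perm σ}
    (hq : ∀ i j, q i j ≠ 0 → i = π j) {a : σ → ℝ} {u : MvPolynomial σ K}
    (hadm : IsAdm u (a ∘ π)) : IsAdm (linSubst σ K q u) a := by
  intro d hd
  have h := le_weight_of_mem_support_linSubst (ω := a ∘ π) (ω' := a)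
    (fun i j hij => by rw [Function.comp_apply, ← hq i j hij]) (f := u) (r := 0)
    (fun e he => by rw [weight_eq_sum]; exact hadm e he) d hd
  rwa [weight_eq_sum] at h

/-- A monomial matrix for `π` moves the weights of test monomials by `π`: `coeff_d(q·x^e) ≠ 0`
implies `⟨b, twt d⟩ = ⟨b ∘ π, twt e⟩` (`∑ b = 0`). [cite: Kempf1978, §2 (the Weyl group acting on `X_*(T)`)] -/
theorem rpair_twt_eq_of_perm {q : Matrix σ σ K} {π : Equiv.Perm σ}
    (hq : ∀ i j, q i j ≠ 0 → i = π j) (b : σ → ℝ) (hb : ∑ i, b i = 0) {d e : DegIdx σ D}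
    (h : coeff d.1 (linSubst σ K q (monomial e.1 1)) ≠ 0) :
    rpair b (twt D d) = rpair (b ∘ π) (twt D e) := by
  have hb' : ∑ i, (b ∘ π) i = 0 := by
    rw [← hb]
    exact Equiv.sum_comp π b
  rw [rpair_twt b hb, rpair_twt (b ∘ π) hb',
    weight_eq_of_coeff_linSubst_monomial_ne_zero_of_perm hq b h]
  rfl

/-- `q⁻¹·(q·u) = u` for `q ∈ SL`. [folklore] -/
private theorem linSubst_inv_linSubst (q : Matrix.SpecialLinearGroup σ K) (u : MvPolynomial σ K) :
    linSubst σ K ((q⁻¹ : Matrix.SpecialLinearGroup σ K) : Matrix σ σ K)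
      (linSubst σ K (q : Matrix σ σ K) u) = u := by
  rw [← AlgHom.comp_apply, ← linSubst_mul, ← Matrix.SpecialLinearGroup.coe_mul, inv_mul_cancel,
    Matrix.SpecialLinearGroup.coe_one, linSubst_one, AlgHom.id_apply]

variable {Q : MvPolynomial σ K} (T : TestSystem D Q)

/-- **Kempf's Lemma 3.2 (c) for `SL_σ`: the numerical function is `P_a`-invariant.** For
`q ∈ SL ∩ P_a` (`a_i < a_j ⇒ q_{ij} = 0`, and the same for `q⁻¹`), `∑ a = 0`, `(u, a)` admissible
with non-empty state: `(q·u, a)` is admissible with non-empty state and `M(q·u, a) = M(u, a)`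
("`m(x, pλp⁻¹) = m(x, λ)` for `p ∈ P(λ)`", written for `u = h·x`, `q = php⁻¹`-free form).
[cite: Kempf1978, Lemma 3.2 (c)] -/
theorem TestSystem.M_linSubst_eq_of_parabolic [Infinite K] (q : Matrix.SpecialLinearGroup σ K)
    {a : σ → ℝ} (ha : ∑ i, a i = 0)
    (hq : ∀ i j, (q : Matrix σ σ K) i j ≠ 0 → a j ≤ a i)
    (hqi : ∀ i j, ((q⁻¹ : Matrix.SpecialLinearGroup σ K) : Matrix σ σ K) i j ≠ 0 → a j ≤ a i)
    {u : MvPolynomial σ K} (hadm : IsAdm u a) (hJ : (T.J u).Nonempty) :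
    IsAdm (linSubst σ K (q : Matrix σ σ K) u) a ∧
      (T.J (linSubst σ K (q : Matrix σ σ K) u)).Nonempty ∧
      T.M (linSubst σ K (q : Matrix σ σ K) u) a = T.M u a := by
  have hadm' : IsAdm (linSubst σ K (q : Matrix σ σ K) u) a := hadm.linSubst_of_parabolic hq
  have h1 := T.M_le_M_linSubst q⁻¹ ha (rpair_twt_le_of_parabolic hqi ha) hadm'
    (by rwa [linSubst_inv_linSubst])
  rw [linSubst_inv_linSubst] at h1
  have h2 := T.M_le_M_linSubst q ha (rpair_twt_le_of_parabolic hq ha) hadm h1.1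
  exact ⟨hadm', h1.1, le_antisymm h1.2 h2.2⟩

/-- **Weyl-group covariance of the numerical function** (Kempf §2: `W` acts on `X_*(T)` and the
length is `W`-invariant): for a monomial matrix `q ∈ SL` with `q_{ij} ≠ 0 ⇒ i = π j` (so
`x_j ↦ ε_j x_{π j}`), `(q·u, a)` is admissible iff `(u, a ∘ π)` is, the states correspond, and
`M(q·u, a) = M(u, a ∘ π)`. [cite: Kempf1978, §2 (the Weyl group acting on `X_*(T)`), Lemma 3.2 (c)] -/
theorem TestSystem.M_linSubst_eq_of_perm [Infinite K] (q : Matrix.SpecialLinearGroup σ K)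
    (π : Equiv.Perm σ) (hq : ∀ i j, (q : Matrix σ σ K) i j ≠ 0 → i = π j)
    (hqi : ∀ i j, ((q⁻¹ : Matrix.SpecialLinearGroup σ K) : Matrix σ σ K) i j ≠ 0 → i = π.symm j)
    {a : σ → ℝ} (ha : ∑ i, a i = 0) {u : MvPolynomial σ K} (hadm : IsAdm u (a ∘ π))
    (hJ : (T.J u).Nonempty) :
    IsAdm (linSubst σ K (q : Matrix σ σ K) u) a ∧
      (T.J (linSubst σ K (q : Matrix σ σ K) u)).Nonempty ∧
      T.M (linSubst σ K (q : Matrix σ σ K) u) a = T.M u (a ∘ π) := by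
  have ha' : ∑ i, (a ∘ π) i = 0 := by
    rw [← ha]
    exact Equiv.sum_comp π a
  have hadm' : IsAdm (linSubst σ K (q : Matrix σ σ K) u) a := hadm.linSubst_of_perm hq
  have hcomp : (a ∘ π) ∘ π.symm = a := by
    funext i
    simp
  have h1 := T.M_le_M_linSubst q⁻¹ (a := a ∘ π) (a' := a) ha
    (fun d e h => by rw [rpair_twt_eq_of_perm hqi (a ∘ π) ha' h, hcomp]) hadm'
    (by rwa [linSubst_inv_linSubst])
  rw [linSubst_inv_linSubst] at h1
  have h2 := T.M_le_M_linSubst q (a := a) (a' := a ∘ π) ha'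
    (fun d e h => by rw [rpair_twt_eq_of_perm hq a ha h]) hadm h1.1
  exact ⟨hadm', h1.1, le_antisymm h1.2 h2.2⟩

/-- **The stabiliser acts on pairs**: `(h·γ)·v = h·v` for `γ·v = v`, so `(hγ, a)` has the same
admissibility, state and numerical function as `(h, a)` (Kempf §3: `Λ_x` is `G_x`-stable).
[cite: Kempf1978, Cor. 3.5] -/
theorem linSubst_mul_of_stabilizer (h γ : Matrix.SpecialLinearGroup σ K) {v : MvPolynomial σ K}
    (hγ : linSubst σ K (γ : Matrix σ σ K) v = v) :
    linSubst σ K ((h * γ : Matrix.SpecialLinearGroup σ K) : Matrix σ σ K) v =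
      linSubst σ K (h : Matrix σ σ K) v := by
  rw [Matrix.SpecialLinearGroup.coe_mul, linSubst_mul, AlgHom.comp_apply, hγ]

end Invariance

section Limit

variable {K : Type} [Field K] {σ : Type} [Fintype σ] [DecidableEq σ] {D : ℕ}
variable {Q : MvPolynomial σ K} (T : TestSystem D Q)

omit [DecidableEq σ] in
/-- Integral admissibility is real admissibility of the cast. [cite: Kempf1978, §2] -/
theorem isAdm_intCast_iff {u : MvPolynomial σ K} {a : σ → ℤ} :
    IsAdm u (fun i => (a i : ℝ)) ↔ ∀ d ∈ u.support, 0 ≤ diagWeight a d := by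
  refine forall₂_congr fun d _ => ?_
  rw [diagWeight_apply]
  show (0 : ℝ) ≤ ∑ i, (a i : ℝ) * ((d i : ℕ) : ℝ) ↔ _
  norm_cast

/-- **A limit in `S` forces positive order** (Kempf §3 with Thm. 1.4: if `lim_{t→0} diag(t^a)·u`
lies in the closed orbit `SL·Q` then every test polynomial not vanishing at `u` has `⟨a, m_j⟩ > 0`,
i.e. `M(u, a) > 0`). Proof: `t ↦ f_j(diag(t^{Na})·u) = t^{⟨a,m_j⟩} f_j(u)` is a polynomial in `t`
whose value at `t = 0` is `f_j(lim) = 0`. [cite: Kempf1978, Lemma 3.2 (b), Thm. 1.4] -/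
theorem TestSystem.ipair_pos_of_diagLimit_mem [Infinite K] {u : MvPolynomial σ K} {a : σ → ℤ}
    (ha : ∑ i, a i = 0) (hadm : ∀ d ∈ u.support, 0 ≤ diagWeight a d)
    (hlim : diagLimit a u ∈ slOrbit σ K Q) {j : Fin T.r} (hj : j ∈ T.J u) :
    0 < ipair a (T.m j) := by
  classical
  set N : ℤ := (Fintype.card σ : ℤ) with hN
  set c : DegIdx σ D → K := formCoeff D u with hc
  have hjne : aeval c (T.f j) ≠ 0 := T.mem_J.mp hj
  -- non-negativity of the exponents on the support
  have hexp : ∀ d : DegIdx σ D, c d ≠ 0 → 0 ≤ N * diagWeight a d.1 := fun d hd =>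
    mul_nonneg (Nat.cast_nonneg _) (hadm d.1 (mem_support_iff.mpr hd))
  -- the one-variable polynomial `t ↦ f_j(diag(t^{Na})·u)`
  set P : K[X] := aeval (fun d : DegIdx σ D =>
    Polynomial.C (c d) * Polynomial.X ^ (N * diagWeight a d.1).toNat) (T.f j) with hP
  have hPeval : ∀ s : K, P.eval s =
      aeval (fun d : DegIdx σ D => c d * s ^ (N * diagWeight a d.1).toNat) (T.f j) := by
    intro s
    have hfun : (fun d : DegIdx σ D => Polynomial.aeval s
        (Polynomial.C (c d) * Polynomial.X ^ (N * diagWeight a d.1).toNat)) =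
        fun d => c d * s ^ (N * diagWeight a d.1).toNat := by
      funext d
      simp
    rw [hP, ← Polynomial.coe_aeval_eq_eval, ← AlgHom.comp_apply, comp_aeval, hfun]
  -- at `s ≠ 0`: `P(s) = s^{⟨a, m_j⟩} f_j(c)`
  have hPne : ∀ s : K, s ≠ 0 → P.eval s = s ^ ipair a (T.m j) * aeval c (T.f j) := by
    intro s hs
    rw [hPeval, ← aeval_torus_of_isWeightedHomogeneous a ha hs c (T.iso j)]
    have hfun : (fun d : DegIdx σ D => c d * s ^ (N * diagWeight a d.1).toNat) =
        fun d => s ^ ((Fintype.card σ : ℤ) * diagWeight a d.1) * c d := by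
      funext d
      by_cases hd : c d = 0
      · rw [hd, zero_mul, mul_zero]
      · rw [mul_comm, ← zpow_natCast, Int.toNat_of_nonneg (hexp d hd)]
    rw [hfun]
  -- at `s = 0`: `P(0) = f_j(lim) = 0`
  have hP0 : P.eval 0 = 0 := by
    rw [hPeval]
    have hfun : (fun d : DegIdx σ D => c d * (0 : K) ^ (N * diagWeight a d.1).toNat) =
        formCoeff D (diagLimit a u) := by
      funext d
      rw [formCoeff_apply, coeff_diagLimit, hc, formCoeff_apply]
      by_cases hd : coeff d.1 u = 0
      · rw [hd, zero_mul, ite_self]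
      by_cases hw : diagWeight a d.1 = 0
      · rw [hw, mul_zero, Int.toNat_zero, pow_zero, mul_one, if_pos rfl]
      · have hpos : 0 < diagWeight a d.1 := lt_of_le_of_ne (hadm d.1 (mem_support_iff.mpr hd)) (Ne.symm hw)
        have hNpos : 0 < N := by
          rw [hN, Int.natCast_pos, Fintype.card_pos_iff]
          by_contra hσ
          rw [not_nonempty_iff] at hσ
          apply hw
          rw [diagWeight_apply]
          exact Finset.sum_eq_zero fun i _ => (IsEmpty.false i).elim
        have hne : (N * diagWeight a d.1).toNat ≠ 0 := by
          have := mul_pos hNpos hpos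
          omega
        rw [zero_pow hne, mul_zero, if_neg hw]
    rw [hfun]
    obtain ⟨g, hg⟩ := hlim
    exact (MvPolynomial.mem_vanishingIdeal_iff.mp (T.mem j)) _ ⟨_, ⟨g, hg⟩, rfl⟩
  -- `⟨a, m_j⟩ ≥ 0` by admissibility
  have hnonneg : 0 ≤ ipair a (T.m j) := by
    have h := rpair_nonneg_of_aeval_formCoeff_ne_zero (isAdm_intCast_iff.mpr hadm)
      (by rw [← Int.cast_sum, ha, Int.cast_zero]) (T.iso j) hjne
    rw [rpair_intCast] at h
    exact_mod_cast h
  rcases hnonneg.lt_or_eq with hlt | heq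
  · exact hlt
  · exfalso
    -- `⟨a, m_j⟩ = 0`: `P` is the non-zero constant `f_j(c)` on `K^×`, contradiction at `0`
    have hPc : P = Polynomial.C (aeval c (T.f j)) := by
      have h0 : P - Polynomial.C (aeval c (T.f j)) = 0 := by
        apply Polynomial.eq_zero_of_infinite_isRoot
        apply Set.Infinite.mono (s := {t : K | t ≠ 0})
        · intro t ht
          rw [Set.mem_setOf_eq, Polynomial.IsRoot.def, Polynomial.eval_sub, Polynomial.eval_C,
            hPne t ht, ← heq, zpow_zero, one_mul, sub_self]
        · exact (Set.finite_singleton (0 : K)).infinite_compl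
      exact sub_eq_zero.mp h0
    apply hjne
    rw [← Polynomial.eval_C (x := (0 : K)) (a := aeval c (T.f j)), ← hPc, hP0]

/-- **A limit in `S` forces `M(u, a) > 0`** (on a non-empty state). [cite: Kempf1978, Lemma 3.2 (b), Thm. 1.4] -/
theorem TestSystem.M_pos_of_diagLimit_mem [Infinite K] {u : MvPolynomial σ K} {a : σ → ℤ}
    (ha : ∑ i, a i = 0) (hadm : ∀ d ∈ u.support, 0 ≤ diagWeight a d)
    (hlim : diagLimit a u ∈ slOrbit σ K Q) (hJ : (T.J u).Nonempty) :
    0 < T.M u (fun i => (a i : ℝ)) := by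
  obtain ⟨j, hj, hM⟩ := T.exists_mem_J_M_eq hJ (fun i => (a i : ℝ))
  rw [hM, rpair_intCast]
  exact_mod_cast T.ipair_pos_of_diagLimit_mem ha hadm hlim hj

end Limit

end Literature.Computability.AlgebraicComplexity
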